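import Literature.Probability.RandomPlanarGeometry.HalfPlaneAutomorphism
import Literature.Probability.RandomPlanarGeometry.UpperHalfPlaneAutomorphisms
import Literature.Topology.PlaneTopology.Crosscut
import HarnessLib

/-!
# Boundary correspondence for chordal uniformizing maps of conformal rectangles (trunk `Stoch`)

Let `R = (Ω; a, b, c, d)` be a conformal rectangle (`Literature.Probability.RandomPlanarGeometry.ConformalRectangle`: a Jordan domain with
four marked boundary points in the cyclic order of the boundary parametrisation) and let
`ψ : ℍₒ → Ω` be a *chordal* uniformizing map of the Dobrushin domain `(Ω; a, c)`
(`MarkedDomain.IsChordalUniformizing`: boundary value `a` at `0` and `c` at `∞`), with boundary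
extension `Ψ = ψ.boundaryExtension`. This is the map through which chordal SLE in `(Ω; a, c)` is
defined (`Literature.Probability.RandomPlanarGeometry.IsSLECurve`), and Cardy's formula for SLE₆ (`CritPerc.sle_six_measureReal_hitsBefore`
of `CritPercSLE`) needs to know where the two boundary arcs `(bc) = R.arc 1` and `(cd) = R.arc 2`
sit in the half-plane picture. The main result of this file,
`Literature.Probability.RandomPlanarGeometry.ConformalRectangle.exists_rays_of_isChordalUniformizing_of_disc`, answers this **from
Carathéodory's theorem in its printed disc form** (`Literature.Probability.RandomPlanarGeometry.JordanDomain.exists_continuousOn_extension`,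
Pommerenke (1992), Thm. 2.6, kept as the hypothesis `hC`):

* there are reals `u, v` of opposite signs (`Ψ v = b`, `Ψ u = d`) such that for `im z ≥ 0`,
  `Ψ z ∈ (bc)` iff `z` is real and lies on the closed real ray from `v` pointing away from `0`,
  and `Ψ z ∈ (cd)` iff `z` is real and lies on the closed ray from `u` pointing away from `0`;
* every uniformizing datum `(φ, x)` of `R` (`ConformalRectangle.IsUniformizing`) has Cardy
  cross-ratio `crossRatio x = |v| / (|u| + |v|)`.

Proof. Let `Φ` be the Carathéodory extension of `ψ ∘ C⁻¹` to the closed disc (`C` the Cayley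
transform; packaged as `JordanDomain.IsDiscExtension`). Pull the boundary loop `R.boundary` back by
`Ψ⁻¹ = C⁻¹ ∘ Φ⁻¹` to the real-valued map `g = JordanDomain.discParam` on the period window
`W = (mark c - 1, mark c)` (the parameters not mapped to `c = Φ 1 = Ψ ∞`). Then `Ψ ∘ g = boundary`
on `W`, `g` is continuous (`Φ⁻¹` is continuous on `closure Ω` as the inverse of a continuous
bijection of the compact disc, `IsCompact.continuousOn_invFunOn`) and injective, hence strictly
monotone or antitone (Mathlib `ContinuousOn.strictMonoOn_of_injOn_Ioo`), surjective onto `ℝ`,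
and `g (mark a) = 0`. With `v = g (mark b)`, `u = g (mark d - 1)` and
`mark d - 1 < mark a < mark b` inside `W`, the arcs `boundary [mark b, mark c]` and
`boundary [mark c - 1, mark d - 1]` become the two rays and `u, v` have opposite signs. For the
cross-ratio, `ψ ∘ M` for an explicit real Möbius self-map `M` of `ℍₒ` (`ConformalEquiv.realMobius`)
sending a monotone quadruple `x⁰` to `(0, v, ∞, u)` is a uniformizing datum with
`crossRatio x⁰ = |v|/(|u|+|v|)` (`exists_isUniformizing_crossRatio_eq`), and any other datum has the
same cross-ratio by `ConformalRectangle.crossRatio_eq_of_isUniformizing_of_disc hC`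
(`HalfPlaneAutomorphism`).

Contents:
* `Literature.ConformalEquiv.realMobius a b c d h : ConformalEquiv ℍₒ ℍₒ`, `z ↦ (a z + b)/(c z + d)` for
  real `a, b, c, d` with `ad - bc > 0`: a thin `abbrev` for the tree's `Literature.Probability.RandomPlanarGeometry.ConformalEquiv.moebius`
  (`UpperHalfPlaneAutomorphisms`, Berenstein–Gay 1991, Exercise 2.3.15 (b)) of the normalised
  matrix `slOfDetPos a b c d h = (a b; c d)/√(ad - bc) ∈ SL(2, ℝ)`; its boundary behaviour
  (`hasBoundaryValue_realMobius_trans`, `hasBoundaryValue_realMobius_trans_pole`) is derived from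
  the tree's transfer lemmas `Literature.Probability.RandomPlanarGeometry.hasBoundaryValue_of_moebius`, `Literature.Probability.RandomPlanarGeometry.hasBoundaryValue_of_moebius_pole`
  (`CritPercCardyFunctionProofs`); the `det > 0` parametrisation only avoids square roots in the
  two explicit matrices of `exists_isUniformizing_crossRatio_eq`;
* `Literature.Probability.RandomPlanarGeometry.IsCompact.continuousOn_invFunOn` (set version of Mathlib's
  `Continuous.continuous_symm_of_equiv_compact_to_t2`);
* `Literature.Probability.RandomPlanarGeometry.JordanDomain.IsDiscExtension`, `Literature.Probability.RandomPlanarGeometry.JordanDomain.discParam` and their API;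
* `Literature.Probability.RandomPlanarGeometry.ConformalRectangle.exists_rays_of_isChordalUniformizing_of_disc`.

## Mathlib

We USE `Matrix.SpecialLinearGroup (Fin 2) ℝ` (through the tree's `Literature.Probability.RandomPlanarGeometry.moebiusFun` /
`Literature.Probability.RandomPlanarGeometry.ConformalEquiv.moebius`, which are Mathlib's `SL(2, ℝ)`-action on the type `UpperHalfPlane`
seen on the set `ℍₒ ⊆ ℂ`), `ContinuousOn.strictMonoOn_of_injOn_Ioo`, `Function.invFunOn`,
`Function.Periodic.exists_mem_Ico`. From the tree: `Literature.Probability.RandomPlanarGeometry.cayley`/`cayleyFun`/`cayleyInvFun` and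
`JordanDomain.tendsto_nhdsWithin_of_extension` (`CaratheodoryHalfPlane`),
`JordanDomain.extension_one_eq` and `ConformalRectangle.crossRatio_eq_of_isUniformizing_of_disc`
(`HalfPlaneAutomorphism`), `ConformalEquiv.moebius`, `hasBoundaryValue_of_moebius(_pole)`
(`UpperHalfPlaneAutomorphisms`, `CritPercCardyFunctionProofs`), `JordanDomain.injOn_boundary_Ico`
(`Literature.Topology.PlaneTopology.Crosscut`).

## References

* Ch. Pommerenke, *Boundary Behaviour of Conformal Maps*, Springer (1992), Thm. 2.6
  (Carathéodory's theorem) and §1.2 (Cayley transform).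
* L. V. Ahlfors, *Complex Analysis*, 3rd ed. (1979), Ch. 3 §3 (linear fractional
  transformations, cross-ratio), Ch. 6 §1.1.
* C. A. Berenstein, R. Gay, *Complex Variables*, GTM 125, Springer (1991), Exercise 2.3.15 (b)
  (`Aut(H) = SL(2, ℝ)/{±I}`).
* W. Werner, *Lectures on two-dimensional critical percolation*, IAS/Park City (2007),
  arXiv:0710.0856, §3 p. 19 (the arcs `(bc)`, `(ca)` seen from a chordal map).
* G. F. Lawler, *Conformally Invariant Processes in the Plane*, AMS (2005), §6.7 (Cardy's
  formula for SLE: the boundary points `1`, `-y` of `ℍ`).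
-/

noncomputable section

open Set Filter Topology Complex Metric
open UpperHalfPlane (upperHalfPlaneSet isOpen_upperHalfPlaneSet)

namespace Literature.Probability.RandomPlanarGeometry


/-! ### Real Möbius self-maps of `ℍₒ` of positive determinant (a thin layer over `ConformalEquiv.moebius`) -/

namespace ConformalEquiv

/-- The normalisation `(a b; c d) / √(ad - bc) ∈ SL(2, ℝ)` of a real `2 × 2` matrix of positive
determinant. [folklore] -/
def slOfDetPos (a b c d : ℝ) (hdet : 0 < a * d - b * c) : Matrix.SpecialLinearGroup (Fin 2) ℝ :=
  ⟨!![a / √(a * d - b * c), b / √(a * d - b * c); c / √(a * d - b * c), d / √(a * d - b * c)], by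
    rw [Matrix.det_fin_two_of]
    have hs : 0 < √(a * d - b * c) := Real.sqrt_pos.2 hdet
    field_simp
    rw [Real.sq_sqrt hdet.le]⟩

section slOfDetPos

variable (a b c d : ℝ) (hdet : 0 < a * d - b * c)

/-- Entry `(0,0)` of the normalised matrix. [folklore] -/
@[simp] theorem slOfDetPos_apply_zero_zero : slOfDetPos a b c d hdet 0 0 = a / √(a * d - b * c) := rfl

/-- Entry `(0,1)` of the normalised matrix. [folklore] -/
@[simp] theorem slOfDetPos_apply_zero_one : slOfDetPos a b c d hdet 0 1 = b / √(a * d - b * c) := rfl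

/-- Entry `(1,0)` of the normalised matrix. [folklore] -/
@[simp] theorem slOfDetPos_apply_one_zero : slOfDetPos a b c d hdet 1 0 = c / √(a * d - b * c) := rfl

/-- Entry `(1,1)` of the normalised matrix. [folklore] -/
@[simp] theorem slOfDetPos_apply_one_one : slOfDetPos a b c d hdet 1 1 = d / √(a * d - b * c) := rfl

/-- The denominator of the normalised matrix at a real point. [folklore] -/
theorem slOfDetPos_den (x : ℝ) :
    slOfDetPos a b c d hdet 1 0 * x + slOfDetPos a b c d hdet 1 1 = (c * x + d) / √(a * d - b * c) := by
  simp only [slOfDetPos_apply_one_zero, slOfDetPos_apply_one_one]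
  ring

/-- Normalising the matrix does not change the Möbius map (real points). [folklore] -/
theorem slOfDetPos_moebius_real (x : ℝ) :
    (slOfDetPos a b c d hdet 0 0 * x + slOfDetPos a b c d hdet 0 1) /
        (slOfDetPos a b c d hdet 1 0 * x + slOfDetPos a b c d hdet 1 1) =
      (a * x + b) / (c * x + d) := by
  have hs : (√(a * d - b * c))⁻¹ ≠ 0 := inv_ne_zero (Real.sqrt_pos.2 hdet).ne'
  simp only [slOfDetPos_apply_zero_zero, slOfDetPos_apply_zero_one, slOfDetPos_apply_one_zero,
    slOfDetPos_apply_one_one]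
  rw [show a / √(a * d - b * c) * x + b / √(a * d - b * c) = (√(a * d - b * c))⁻¹ * (a * x + b) by
      ring, show c / √(a * d - b * c) * x + d / √(a * d - b * c) =
      (√(a * d - b * c))⁻¹ * (c * x + d) by ring, mul_div_mul_left _ _ hs]

/-- Normalising the matrix does not change the Möbius map (`moebiusFun`, all of `ℂ`, junk values
included). [folklore] -/
theorem moebiusFun_slOfDetPos (z : ℂ) :
    moebiusFun (slOfDetPos a b c d hdet) z = (a * z + b) / (c * z + d) := by
  have hs : ((√(a * d - b * c) : ℝ) : ℂ)⁻¹ ≠ 0 :=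
    inv_ne_zero (by exact_mod_cast (Real.sqrt_pos.2 hdet).ne')
  simp only [moebiusFun, slOfDetPos_apply_zero_zero, slOfDetPos_apply_zero_one,
    slOfDetPos_apply_one_zero, slOfDetPos_apply_one_one]
  push_cast
  rw [show (a : ℂ) / (√(a * d - b * c) : ℝ) * z + (b : ℂ) / (√(a * d - b * c) : ℝ) =
      ((√(a * d - b * c) : ℝ) : ℂ)⁻¹ * (a * z + b) by ring,
    show (c : ℂ) / (√(a * d - b * c) : ℝ) * z + (d : ℂ) / (√(a * d - b * c) : ℝ) =
      ((√(a * d - b * c) : ℝ) : ℂ)⁻¹ * (c * z + d) by ring, mul_div_mul_left _ _ hs]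

/-- **Real Möbius self-maps of `ℍₒ` of positive determinant**: for real `a, b, c, d` with
`ad - bc > 0`, `z ↦ (a z + b)/(c z + d)` as a conformal automorphism of `ℍₒ`. This is the tree's
`Literature.Probability.RandomPlanarGeometry.ConformalEquiv.moebius` (Berenstein–Gay 1991, Exercise 2.3.15 (b); Mathlib's `SL(2, ℝ)`
action on `UpperHalfPlane`) of the normalised matrix `slOfDetPos a b c d hdet`; the `det > 0`
parametrisation only saves square roots in explicit computations. [cite: BerensteinGay1991, Exercise 2.3.15 (b)] -/
abbrev realMobius : ConformalEquiv upperHalfPlaneSet upperHalfPlaneSet :=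
  ConformalEquiv.moebius (slOfDetPos a b c d hdet)

/-- The real Möbius map acts as `z ↦ (a z + b)/(c z + d)`. [folklore] -/
@[simp] theorem realMobius_apply (z : ℂ) : realMobius a b c d hdet z = (a * z + b) / (c * z + d) :=
  moebiusFun_slOfDetPos a b c d hdet z

variable {a b c d} {V : Set ℂ} (ψ : ConformalEquiv upperHalfPlaneSet V)

/-- Boundary value of `ψ ∘ M` at a regular real point `x` of the real Möbius map `M`: it is the
boundary value of `ψ` at `M x` (the tree's transfer lemma `Literature.Probability.RandomPlanarGeometry.hasBoundaryValue_of_moebius`).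
[folklore] -/
theorem hasBoundaryValue_realMobius_trans {x : ℝ} (hx : c * x + d ≠ 0) {p : ℂ}
    (hψ : ψ.HasBoundaryValue ((a * x + b) / (c * x + d) : ℝ) p) :
    ((realMobius a b c d hdet).trans ψ).HasBoundaryValue x p := by
  refine hasBoundaryValue_of_moebius (Φ := ψ) (g := slOfDetPos a b c d hdet) (fun z _ ↦ rfl) ?_ ?_
  · rw [slOfDetPos_den]
    exact div_ne_zero hx (Real.sqrt_pos.2 hdet).ne'
  · rwa [slOfDetPos_moebius_real]

/-- Boundary value of `ψ ∘ M` at the real pole `x` of the real Möbius map `M`: it is the boundary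
value of `ψ` at `∞` (the tree's transfer lemma `Literature.Probability.RandomPlanarGeometry.hasBoundaryValue_of_moebius_pole`).
[folklore] -/
theorem hasBoundaryValue_realMobius_trans_pole {x : ℝ} (hx : c * x + d = 0) {p : ℂ}
    (hψ : ψ.HasBoundaryValueAtInfty p) :
    ((realMobius a b c d hdet).trans ψ).HasBoundaryValue x p := by
  refine hasBoundaryValue_of_moebius_pole (Φ := ψ) (g := slOfDetPos a b c d hdet)
    (fun z _ ↦ rfl) ?_ hψ
  rw [slOfDetPos_den, hx, zero_div]

end slOfDetPos

end ConformalEquiv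


/-! ### Topological preliminaries -/

/-- **The inverse of a continuous injection on a compact set is continuous** (with values in a
Hausdorff space): closed subsets of the compact set have compact, hence closed, images. Set
version (`ContinuousOn`/`InjOn`/`Function.invFunOn`) of Mathlib's
`Continuous.continuous_symm_of_equiv_compact_to_t2`. [folklore] -/
theorem IsCompact.continuousOn_invFunOn {X Y : Type*} [TopologicalSpace X] [TopologicalSpace Y]
    [T2Space Y] [Nonempty X] {s : Set X} (hs : IsCompact s) {f : X → Y} (hf : ContinuousOn f s)
    (hinj : InjOn f s) : ContinuousOn (Function.invFunOn f s) (f '' s) := by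
  rw [continuousOn_iff_isClosed]
  intro C hC
  refine ⟨f '' (s ∩ C),
    ((hs.inter_right hC).image_of_continuousOn (hf.mono inter_subset_left)).isClosed, ?_⟩
  ext y
  constructor
  · rintro ⟨hyC, x, hx, rfl⟩
    exact ⟨⟨Function.invFunOn f s (f x), ⟨Function.invFunOn_mem ⟨x, hx, rfl⟩, hyC⟩,
      Function.invFunOn_eq ⟨x, hx, rfl⟩⟩, x, hx, rfl⟩
  · rintro ⟨⟨x, ⟨hxs, hxC⟩, rfl⟩, -⟩
    refine ⟨?_, x, hxs, rfl⟩
    show Function.invFunOn f s (f x) ∈ C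
    rw [hinj.leftInvOn_invFunOn hxs]
    exact hxC

/-- The Cayley transform never takes the value `1` (`(z - i)/(z + i) = 1` is impossible, and the
junk value at `z = -i` is `0`). [folklore] -/
theorem cayleyFun_ne_one (z : ℂ) : cayleyFun z ≠ 1 := by
  rw [cayleyFun_apply]
  intro h
  by_cases hz : z + I = 0
  · rw [hz, div_zero] at h
    exact zero_ne_one h
  · rw [div_eq_one_iff_eq hz] at h
    have := congrArg Complex.im h
    simp only [sub_im, I_im, add_im] at this
    linarith

namespace JordanDomain

variable (D : JordanDomain)

/-- Every boundary point is `boundary t` for some `t` in any prescribed period window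
`[a, a + 1)`. [folklore] -/
theorem exists_mem_Ico_boundary_eq {p : ℂ} (hp : p ∈ frontier D.carrier) (a : ℝ) :
    ∃ t ∈ Ico a (a + 1), D.boundary t = p := by
  rw [← D.range_boundary] at hp
  obtain ⟨t₀, rfl⟩ := hp
  obtain ⟨t, ht, hteq⟩ := D.periodic_boundary.exists_mem_Ico one_pos t₀ a
  exact ⟨t, ht, hteq.symm⟩

/-- An open set does not meet its frontier: points of a Jordan domain are not boundary points.
[folklore] -/
theorem notMem_frontier_of_mem {z : ℂ} (hz : z ∈ D.carrier) : z ∉ frontier D.carrier := by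
  intro hz'
  have : z ∈ D.carrier ∩ frontier D.carrier := ⟨hz, hz'⟩
  rw [D.isOpen.inter_frontier_eq] at this
  exact this

/-! ### Carathéodory disc extensions of `φ : ℍₒ → D` and the pulled-back boundary parametrisation -/

/-- A **Carathéodory disc extension** for a conformal map `φ : ℍₒ → D` onto a Jordan domain: a map
`Φ`, continuous on the closed unit disc, extending `φ ∘ cayley⁻¹ : 𝔻 → D`, bijective from the
closed disc onto `closure D` and from the unit circle onto `∂D`. This is exactly the conclusion
of Carathéodory's theorem `JordanDomain.exists_continuousOn_extension` (Pommerenke, *Boundary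
Behaviour of Conformal Maps* (1992), Thm 2.6) applied to `φ ∘ cayley⁻¹`
(`exists_isDiscExtension`). [folklore] -/
structure IsDiscExtension (D : JordanDomain) (φ : ConformalEquiv upperHalfPlaneSet D.carrier)
    (Φ : ℂ → ℂ) : Prop where
  /-- `Φ` is continuous on the closed unit disc. -/
  continuousOn : ContinuousOn Φ (closedBall 0 1)
  /-- `Φ` extends `φ ∘ cayley⁻¹` on the open disc. -/
  eqOn : EqOn Φ (cayley.symm.trans φ) (ball 0 1)
  /-- `Φ` is a bijection from the closed disc onto `closure D`. -/
  bijOn : BijOn Φ (closedBall 0 1) (closure D.carrier)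
  /-- `Φ` is a bijection from the unit circle onto `∂D`. -/
  bijOn_sphere : BijOn Φ (sphere 0 1) (frontier D.carrier)

variable {D}

/-- Carathéodory's theorem (disc form) provides a disc extension for every `φ : ℍₒ → D`.
[cite: PommerenkeBBCM1992, Thm. 2.6] -/
theorem exists_isDiscExtension (hC : exists_continuousOn_extension)
    (φ : ConformalEquiv upperHalfPlaneSet D.carrier) : ∃ Φ, IsDiscExtension D φ Φ := by
  obtain ⟨Φ, h1, h2, h3, h4⟩ := hC D (cayley.symm.trans φ)
  exact ⟨Φ, h1, h2, h3, h4⟩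

/-- The **pulled-back boundary parametrisation**: for a boundary parameter `t`, the real point
`x = discParam D Φ t` with `Ψ x = boundary t`, namely `x = cayley⁻¹ (Φ⁻¹ (boundary t))`
(meaningful when `boundary t ≠ Φ 1`, the boundary value at `∞`). [folklore] -/
def discParam (D : JordanDomain) (Φ : ℂ → ℂ) (t : ℝ) : ℝ :=
  (cayleyInvFun (Function.invFunOn Φ (closedBall 0 1) (D.boundary t))).re

/-- Points of `ℍₒ` are mapped by the boundary extension into `D`, hence off `∂D`. [folklore] -/
theorem boundaryExtension_notMem_frontier (φ : ConformalEquiv upperHalfPlaneSet D.carrier)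
    {z : ℂ} (hz : 0 < z.im) : φ.boundaryExtension z ∉ frontier D.carrier := by
  rw [φ.boundaryExtension_eq hz]
  exact D.notMem_frontier_of_mem (φ.mapsTo hz)

/-- If a point of the closed upper half-plane is mapped to `∂D` by the boundary extension, it is
real. [folklore] -/
theorem im_eq_zero_of_boundaryExtension_mem_frontier
    (φ : ConformalEquiv upperHalfPlaneSet D.carrier) {z : ℂ} (hz : 0 ≤ z.im)
    (hmem : φ.boundaryExtension z ∈ frontier D.carrier) : z.im = 0 := by
  rcases hz.lt_or_eq with hlt | heq
  · exact absurd hmem (boundaryExtension_notMem_frontier φ hlt)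
  · exact heq.symm

/-- The boundary extension at a point of the closed half-plane is the boundary value there, if
any (uniqueness of limits). [folklore] -/
theorem boundaryExtension_eq_of_hasBoundaryValue' (φ : ConformalEquiv upperHalfPlaneSet D.carrier)
    {z p : ℂ} (hz : 0 ≤ z.im) (hp : φ.HasBoundaryValue z p) : φ.boundaryExtension z = p :=
  φ.boundaryExtension_eq_of_hasBoundaryValue (mem_closure_upperHalfPlaneSet_iff.2 hz) hp

namespace IsDiscExtension

variable {φ : ConformalEquiv upperHalfPlaneSet D.carrier} {Φ : ℂ → ℂ} (h : IsDiscExtension D φ Φ)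
include h

/-- The boundary extension of `φ` is `Φ ∘ cayleyFun` on the closed upper half-plane. [folklore] -/
theorem boundaryExtension_eq {z : ℂ} (hz : 0 ≤ z.im) : φ.boundaryExtension z = Φ (cayleyFun z) :=
  boundaryExtension_eq_of_extension φ h.continuousOn h.eqOn hz

/-- `φ` tends to its boundary extension within `ℍₒ` at every point of the closed half-plane.
[folklore] -/
theorem tendsto_nhdsWithin {z : ℂ} (hz : 0 ≤ z.im) :
    Tendsto φ (𝓝[upperHalfPlaneSet] z) (𝓝 (φ.boundaryExtension z)) := by
  rw [h.boundaryExtension_eq hz]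
  exact tendsto_nhdsWithin_of_extension φ h.continuousOn h.eqOn hz

/-- `φ` tends to `Φ 1` at infinity within `ℍₒ`. [folklore] -/
theorem tendsto_cocompact : Tendsto φ (cocompact ℂ ⊓ 𝓟 upperHalfPlaneSet) (𝓝 (Φ 1)) :=
  tendsto_cocompact_of_extension φ h.continuousOn h.eqOn

/-- `Φ 1` is the boundary value of `φ` at infinity (`JordanDomain.extension_one_eq`). [folklore] -/
theorem apply_one_eq {p : ℂ} (hp : φ.HasBoundaryValueAtInfty p) : Φ 1 = p :=
  extension_one_eq φ h.continuousOn h.eqOn hp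

/-- Real points are mapped to `∂D`. [folklore] -/
theorem boundaryExtension_ofReal_mem_frontier (x : ℝ) :
    φ.boundaryExtension x ∈ frontier D.carrier := by
  rw [h.boundaryExtension_eq (by simp)]
  exact h.bijOn_sphere.mapsTo (mem_sphere_zero_iff_norm.2 (norm_cayleyFun_ofReal x))

/-- Real points are not mapped to the boundary value at infinity `Φ 1` (injectivity of `Φ` on
the closed disc, `cayleyFun x ≠ 1`). [folklore] -/
theorem boundaryExtension_ofReal_ne (x : ℝ) : φ.boundaryExtension x ≠ Φ 1 := by
  rw [h.boundaryExtension_eq (by simp)]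
  intro heq
  have := h.bijOn.injOn (mem_closedBall_zero_iff.2 (norm_cayleyFun_le_one (by simp)))
    (mem_closedBall_zero_iff.2 (by simp)) heq
  exact cayleyFun_ne_one _ this

/-- `Φ⁻¹` (the inverse on the closed disc) maps boundary points to the unit circle, and is a
right inverse there. [folklore] -/
theorem invFunOn_mem_sphere {p : ℂ} (hp : p ∈ frontier D.carrier) :
    Function.invFunOn Φ (closedBall 0 1) p ∈ sphere (0 : ℂ) 1 ∧
      Φ (Function.invFunOn Φ (closedBall 0 1) p) = p := by
  obtain ⟨ζ, hζ, rfl⟩ := h.bijOn_sphere.surjOn hp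
  rw [h.bijOn.injOn.leftInvOn_invFunOn (sphere_subset_closedBall hζ)]
  exact ⟨hζ, rfl⟩

/-- `Φ⁻¹ (boundary t) ≠ 1` as soon as `boundary t ≠ Φ 1`. [folklore] -/
theorem invFunOn_boundary_ne_one {t : ℝ} (ht : D.boundary t ≠ Φ 1) :
    Function.invFunOn Φ (closedBall 0 1) (D.boundary t) ≠ 1 := by
  intro h1
  have := (h.invFunOn_mem_sphere (D.boundary_mem_frontier t)).2
  rw [h1] at this
  exact ht this.symm

/-- **The pulled-back parametrisation is a section of the boundary extension**:
`Ψ (discParam t) = boundary t` whenever `boundary t ≠ Φ 1`. [folklore] -/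
theorem boundaryExtension_discParam {t : ℝ} (ht : D.boundary t ≠ Φ 1) :
    φ.boundaryExtension (discParam D Φ t) = D.boundary t := by
  obtain ⟨hs, hΦ⟩ := h.invFunOn_mem_sphere (D.boundary_mem_frontier t)
  have hζ1 : ‖Function.invFunOn Φ (closedBall 0 1) (D.boundary t)‖ = 1 :=
    mem_sphere_zero_iff_norm.1 hs
  rw [h.boundaryExtension_eq (by simp), discParam, ← cayleyInvFun_eq_ofReal_re hζ1,
    cayleyFun_cayleyInvFun (h.invFunOn_boundary_ne_one ht), hΦ]

/-- If `boundary t = Ψ x` for a real `x`, then `discParam t = x`. [folklore] -/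
theorem discParam_eq {t x : ℝ} (ht : D.boundary t = φ.boundaryExtension x) :
    discParam D Φ t = x := by
  rw [discParam, ht, h.boundaryExtension_eq (by simp),
    h.bijOn.injOn.leftInvOn_invFunOn
      (mem_closedBall_zero_iff.2 (norm_cayleyFun_le_one (by simp))),
    cayleyInvFun_cayleyFun (add_I_ne_zero (by simp)), ofReal_re]

/-- Every real `x` is `discParam t` for a parameter `t` in any prescribed period window
`[a, a + 1)`, with `boundary t = Ψ x`. [folklore] -/
theorem exists_mem_Ico_discParam_eq (x a : ℝ) :
    ∃ t ∈ Ico a (a + 1), D.boundary t = φ.boundaryExtension x ∧ discParam D Φ t = x := by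
  obtain ⟨t, ht, heq⟩ :=
    D.exists_mem_Ico_boundary_eq (h.boundaryExtension_ofReal_mem_frontier x) a
  exact ⟨t, ht, heq, h.discParam_eq heq⟩

/-- **Continuity of the pulled-back parametrisation** away from the parameters of `Φ 1`:
`Φ⁻¹` is continuous on `closure D` (continuous bijection from the compact closed disc), and
`cayley⁻¹` is continuous away from `1`. [folklore] -/
theorem continuousOn_discParam : ContinuousOn (discParam D Φ) {t | D.boundary t ≠ Φ 1} := by
  have h1 : ContinuousOn (Function.invFunOn Φ (closedBall 0 1)) (closure D.carrier) := by
    rw [← h.bijOn.image_eq]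
    exact IsCompact.continuousOn_invFunOn (isCompact_closedBall 0 1) h.continuousOn
      h.bijOn.injOn
  have h2 : ContinuousOn (fun t ↦ Function.invFunOn Φ (closedBall 0 1) (D.boundary t))
      {t | D.boundary t ≠ Φ 1} :=
    h1.comp D.continuous_boundary.continuousOn fun t _ ↦
      frontier_subset_closure (D.boundary_mem_frontier t)
  have h3 : ContinuousOn
      (fun t ↦ cayleyInvFun (Function.invFunOn Φ (closedBall 0 1) (D.boundary t)))
      {t | D.boundary t ≠ Φ 1} :=
    differentiableOn_cayleyInvFun.continuousOn.comp h2 fun t ht ↦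
      h.invFunOn_boundary_ne_one ht
  exact continuous_re.comp_continuousOn h3

end IsDiscExtension

end JordanDomain

/-! ### Order bookkeeping: rays seen through a strictly monotone parametrisation -/

/-- For a strictly monotone or antitone `g` on `W` vanishing at `t₀ ∈ W`, the real number `g t`
lies on the closed ray from `g t₁ ≠ 0` pointing away from `0` iff `t` lies beyond `t₁` as seen
from `t₀`. (Pure order theory; used to translate boundary arcs into real rays.) [folklore] -/
theorem ray_iff_of_strictMonoOn_or_strictAntiOn {g : ℝ → ℝ} {W : Set ℝ}
    (hg : StrictMonoOn g W ∨ StrictAntiOn g W) {t₀ t₁ t : ℝ} (ht₀ : t₀ ∈ W) (ht₁ : t₁ ∈ W)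
    (ht : t ∈ W) (h0 : g t₀ = 0) (hne : t₁ ≠ t₀) :
    ((0 < g t₁ → g t₁ ≤ g t) ∧ (g t₁ < 0 → g t ≤ g t₁)) ↔
      ((t₀ < t₁ → t₁ ≤ t) ∧ (t₁ < t₀ → t ≤ t₁)) := by
  rcases hg with hg | hg
  · rcases lt_or_gt_of_ne hne with hlt | hlt
    · have hneg : g t₁ < 0 := h0 ▸ hg ht₁ ht₀ hlt
      simp only [not_lt.2 hneg.le, hneg, not_lt.2 hlt.le, hlt, false_imp_iff, true_and,
        forall_const]
      exact hg.le_iff_le ht ht₁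
    · have hpos : 0 < g t₁ := h0 ▸ hg ht₀ ht₁ hlt
      simp only [hpos, not_lt.2 hpos.le, hlt, not_lt.2 hlt.le, false_imp_iff, and_true,
        forall_const]
      exact hg.le_iff_le ht₁ ht
  · rcases lt_or_gt_of_ne hne with hlt | hlt
    · have hpos : 0 < g t₁ := h0 ▸ hg ht₁ ht₀ hlt
      simp only [hpos, not_lt.2 hpos.le, not_lt.2 hlt.le, hlt, false_imp_iff, and_true,
        true_and, forall_const]
      exact hg.le_iff_ge ht₁ ht
    · have hneg : g t₁ < 0 := h0 ▸ hg ht₀ ht₁ hlt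
      simp only [not_lt.2 hneg.le, hneg, hlt, not_lt.2 hlt.le, false_imp_iff, and_true,
        true_and, forall_const]
      exact hg.le_iff_ge ht ht₁

/-! ### Conformal rectangles: the chordal uniformizing map on the boundary -/

namespace ConformalRectangle

variable (R : ConformalRectangle)

/-- The arc `(bc)` of a conformal rectangle `(Ω; a, b, c, d)` is `boundary [mark 1, mark 2]`.
[folklore] -/
theorem arc_one_eq : R.arc 1 = R.boundary '' Icc (R.mark 1) (R.mark 2) := by
  rw [MarkedDomain.arc, MarkedDomain.nextMark, dif_pos (by decide)]
  rfl

/-- The arc `(cd)` of a conformal rectangle `(Ω; a, b, c, d)` is `boundary [mark 2, mark 3]`.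
[folklore] -/
theorem arc_two_eq : R.arc 2 = R.boundary '' Icc (R.mark 2) (R.mark 3) := by
  rw [MarkedDomain.arc, MarkedDomain.nextMark, dif_pos (by decide)]
  rfl

/-- By periodicity, the arc `(cd)` is also `boundary [mark 2 - 1, mark 3 - 1]`. [folklore] -/
theorem arc_two_eq' : R.arc 2 = R.boundary '' Icc (R.mark 2 - 1) (R.mark 3 - 1) := by
  rw [arc_two_eq]
  ext p
  simp only [mem_image, mem_Icc]
  constructor
  · rintro ⟨t, ht, rfl⟩
    exact ⟨t - 1, ⟨by linarith [ht.1], by linarith [ht.2]⟩, R.periodic_boundary.sub_eq t⟩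
  · rintro ⟨t, ht, rfl⟩
    exact ⟨t + 1, ⟨by linarith [ht.1], by linarith [ht.2]⟩, R.periodic_boundary t⟩

/-- `mark 0` lies in the period window `(mark 2 - 1, mark 2)`. [folklore] -/
theorem mark_zero_mem_Ioo : R.mark 0 ∈ Ioo (R.mark 2 - 1) (R.mark 2) :=
  ⟨by linarith [(R.mark_mem 2).2, (R.mark_mem 0).1], R.strictMono_mark (by decide)⟩

/-- `mark 1` lies in the period window `(mark 2 - 1, mark 2)`. [folklore] -/
theorem mark_one_mem_Ioo : R.mark 1 ∈ Ioo (R.mark 2 - 1) (R.mark 2) :=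
  ⟨by linarith [(R.mark_mem 2).2, (R.mark_mem 1).1], R.strictMono_mark (by decide)⟩

/-- `mark 3 - 1` lies in the period window `(mark 2 - 1, mark 2)`. [folklore] -/
theorem mark_three_sub_one_mem_Ioo : R.mark 3 - 1 ∈ Ioo (R.mark 2 - 1) (R.mark 2) :=
  ⟨by linarith [R.strictMono_mark (show (2 : Fin 4) < 3 by decide)],
    by linarith [(R.mark_mem 3).2, (R.mark_mem 0).1,
      R.strictMono_mark (show (0 : Fin 4) < 2 by decide)]⟩

/-- The period window `(mark 2 - 1, mark 2)` sits inside the half-open period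
`[mark 2 - 1, mark 2 - 1 + 1)`, on which `boundary` is injective. [folklore] -/
theorem Ioo_subset_Ico : Ioo (R.mark 2 - 1) (R.mark 2) ⊆ Ico (R.mark 2 - 1) (R.mark 2 - 1 + 1) :=
  fun _ ht ↦ ⟨ht.1.le, by linarith [ht.2]⟩

variable {R} {ψ : ConformalEquiv upperHalfPlaneSet R.carrier} {Φ : ℂ → ℂ}
  (h : JordanDomain.IsDiscExtension R.toJordanDomain ψ Φ)
  (h₂ : ψ.HasBoundaryValueAtInfty (R.pt 2))

section

include h h₂

/-- For a chordal map towards `c = pt 2`, `Φ 1 = c`. [folklore] -/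
theorem apply_one_eq_pt_two : Φ 1 = R.pt 2 :=
  h.apply_one_eq h₂

/-- Inside the period window `(mark 2 - 1, mark 2)` no parameter is mapped to `c = Φ 1`.
[folklore] -/
theorem boundary_ne_apply_one {t : ℝ} (ht : t ∈ Ioo (R.mark 2 - 1) (R.mark 2)) :
    R.boundary t ≠ Φ 1 := by
  rw [apply_one_eq_pt_two h h₂, MarkedDomain.pt, ← R.periodic_boundary.sub_eq (R.mark 2)]
  intro heq
  have := R.injOn_boundary_Ico (R.mark 2 - 1) (R.Ioo_subset_Ico ht)
    ⟨le_rfl, by linarith⟩ heq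
  exact ht.1.ne' this

/-- The pulled-back parametrisation is continuous on the period window. [folklore] -/
theorem continuousOn_discParam_Ioo :
    ContinuousOn (JordanDomain.discParam R.toJordanDomain Φ) (Ioo (R.mark 2 - 1) (R.mark 2)) :=
  h.continuousOn_discParam.mono fun _ ht ↦ boundary_ne_apply_one h h₂ ht

/-- The pulled-back parametrisation is injective on the period window (apply `Ψ` and use
injectivity of `boundary` on a period). [folklore] -/
theorem injOn_discParam_Ioo :
    InjOn (JordanDomain.discParam R.toJordanDomain Φ) (Ioo (R.mark 2 - 1) (R.mark 2)) := by
  intro t ht s hs hts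
  have key : R.boundary t = R.boundary s := by
    rw [← h.boundaryExtension_discParam (boundary_ne_apply_one h h₂ ht),
      ← h.boundaryExtension_discParam (boundary_ne_apply_one h h₂ hs)]
    exact congrArg _ (congrArg _ hts)
  exact R.injOn_boundary_Ico (R.mark 2 - 1) (R.Ioo_subset_Ico ht) (R.Ioo_subset_Ico hs) key

/-- **The pulled-back parametrisation is strictly monotone or strictly antitone on the period
window** (continuous and injective on an interval). [folklore] -/
theorem strictMonoOn_or_strictAntiOn_discParam :
    StrictMonoOn (JordanDomain.discParam R.toJordanDomain Φ) (Ioo (R.mark 2 - 1) (R.mark 2)) ∨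
      StrictAntiOn (JordanDomain.discParam R.toJordanDomain Φ) (Ioo (R.mark 2 - 1) (R.mark 2)) :=
  (continuousOn_discParam_Ioo h h₂).strictMonoOn_of_injOn_Ioo (by linarith)
    (injOn_discParam_Ioo h h₂)

/-- Every real `x` is `discParam t` for a unique-ish `t` in the period window, with
`boundary t = Ψ x`. [folklore] -/
theorem exists_mem_Ioo_discParam_eq (x : ℝ) : ∃ t ∈ Ioo (R.mark 2 - 1) (R.mark 2),
    R.boundary t = ψ.boundaryExtension x ∧ JordanDomain.discParam R.toJordanDomain Φ t = x := by
  obtain ⟨t, ht, hbt, hpt⟩ := h.exists_mem_Ico_discParam_eq x (R.mark 2 - 1)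
  refine ⟨t, ⟨ht.1.lt_of_ne ?_, by linarith [ht.2]⟩, hbt, hpt⟩
  rintro rfl
  refine h.boundaryExtension_ofReal_ne x ?_
  rw [← hbt, apply_one_eq_pt_two h h₂, MarkedDomain.pt, ← R.periodic_boundary.sub_eq (R.mark 2)]

/-- Inside the period window, `boundary t ∈ (bc)` iff `mark 1 ≤ t`. [folklore] -/
theorem boundary_mem_arc_one_iff {t : ℝ} (ht : t ∈ Ioo (R.mark 2 - 1) (R.mark 2)) :
    R.boundary t ∈ R.arc 1 ↔ R.mark 1 ≤ t := by
  rw [arc_one_eq]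
  constructor
  · rintro ⟨t', ht', heq⟩
    have ht'2 : t' ≠ R.mark 2 := by
      rintro rfl
      exact boundary_ne_apply_one h h₂ ht (by rw [← heq, apply_one_eq_pt_two h h₂, MarkedDomain.pt])
    have ht'W : t' ∈ Ioo (R.mark 2 - 1) (R.mark 2) :=
      ⟨by linarith [ht'.1, (R.mark_one_mem_Ioo).1], ht'.2.lt_of_ne ht'2⟩
    have := R.injOn_boundary_Ico (R.mark 2 - 1) (R.Ioo_subset_Ico ht'W) (R.Ioo_subset_Ico ht) heq
    rw [← this]
    exact ht'.1
  · intro hle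
    exact ⟨t, ⟨hle, ht.2.le⟩, rfl⟩

/-- Inside the period window, `boundary t ∈ (cd)` iff `t ≤ mark 3 - 1`. [folklore] -/
theorem boundary_mem_arc_two_iff {t : ℝ} (ht : t ∈ Ioo (R.mark 2 - 1) (R.mark 2)) :
    R.boundary t ∈ R.arc 2 ↔ t ≤ R.mark 3 - 1 := by
  rw [arc_two_eq']
  constructor
  · rintro ⟨t', ht', heq⟩
    have ht'2 : t' ≠ R.mark 2 - 1 := by
      rintro rfl
      refine boundary_ne_apply_one h h₂ ht ?_
      rw [← heq, apply_one_eq_pt_two h h₂, MarkedDomain.pt, R.periodic_boundary.sub_eq]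
    have ht'W : t' ∈ Ioo (R.mark 2 - 1) (R.mark 2) :=
      ⟨ht'.1.lt_of_ne' ht'2, by linarith [ht'.2, (R.mark_three_sub_one_mem_Ioo).2]⟩
    have := R.injOn_boundary_Ico (R.mark 2 - 1) (R.Ioo_subset_Ico ht'W) (R.Ioo_subset_Ico ht) heq
    rw [← this]
    exact ht'.2
  · intro hle
    exact ⟨t, ⟨ht.1.le, hle⟩, rfl⟩

end

variable (h₀ : ψ.HasBoundaryValue 0 (R.pt 0))
include h h₀ h₂

omit h₂ in
/-- The pulled-back parametrisation vanishes at `mark 0` (`Ψ 0 = a = boundary (mark 0)`).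
[folklore] -/
theorem discParam_mark_zero : JordanDomain.discParam R.toJordanDomain Φ (R.mark 0) = 0 := by
  refine h.discParam_eq ?_
  rw [ofReal_zero, JordanDomain.boundaryExtension_eq_of_hasBoundaryValue' ψ (by simp) h₀]
  rfl

/-- **Boundary arcs pull back to real rays.** With `v = discParam (mark 1)` and
`u = discParam (mark 3 - 1)`: for `im z ≥ 0`, `Ψ z ∈ (bc)` iff `z` is real and on the closed ray
from `v` away from `0`, and `Ψ z ∈ (cd)` iff `z` is real and on the closed ray from `u` away
from `0`. [folklore] -/
theorem boundaryExtension_mem_arc_iff {z : ℂ} (hz : 0 ≤ z.im) :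
    (ψ.boundaryExtension z ∈ R.arc 1 ↔
      z.im = 0 ∧ (0 < JordanDomain.discParam R.toJordanDomain Φ (R.mark 1) →
          JordanDomain.discParam R.toJordanDomain Φ (R.mark 1) ≤ z.re) ∧
        (JordanDomain.discParam R.toJordanDomain Φ (R.mark 1) < 0 →
          z.re ≤ JordanDomain.discParam R.toJordanDomain Φ (R.mark 1))) ∧
    (ψ.boundaryExtension z ∈ R.arc 2 ↔
      z.im = 0 ∧ (0 < JordanDomain.discParam R.toJordanDomain Φ (R.mark 3 - 1) →
          JordanDomain.discParam R.toJordanDomain Φ (R.mark 3 - 1) ≤ z.re) ∧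
        (JordanDomain.discParam R.toJordanDomain Φ (R.mark 3 - 1) < 0 →
          z.re ≤ JordanDomain.discParam R.toJordanDomain Φ (R.mark 3 - 1))) := by
  set g := JordanDomain.discParam R.toJordanDomain Φ with hg
  have hmono := strictMonoOn_or_strictAntiOn_discParam h h₂
  have hg0 : g (R.mark 0) = 0 := discParam_mark_zero h h₀
  -- reduction to real `z`
  have hreal : ∀ i : Fin 4, ψ.boundaryExtension z ∈ R.arc i → z.im = 0 := fun i hmem ↦
    JordanDomain.im_eq_zero_of_boundaryExtension_mem_frontier ψ hz (R.arc_subset_frontier i hmem)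
  have hzre : z.im = 0 → z = ((z.re : ℝ) : ℂ) := fun him ↦
    Complex.ext (by simp) (by simp [him])
  obtain ⟨t, ht, hbt, hgt⟩ := exists_mem_Ioo_discParam_eq h h₂ z.re
  have h01 : R.mark 0 < R.mark 1 := R.strictMono_mark (by decide)
  have h30 : R.mark 3 - 1 < R.mark 0 := by
    linarith [(R.mark_mem 3).2, (R.mark_mem 0).1]
  have key1 := ray_iff_of_strictMonoOn_or_strictAntiOn hmono R.mark_zero_mem_Ioo
    R.mark_one_mem_Ioo ht hg0 h01.ne'
  have key2 := ray_iff_of_strictMonoOn_or_strictAntiOn hmono R.mark_zero_mem_Ioo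
    R.mark_three_sub_one_mem_Ioo ht hg0 h30.ne
  simp only [h01, not_lt.2 h01.le, h30, not_lt.2 h30.le, false_imp_iff, and_true, true_and,
    forall_const] at key1 key2
  rw [hgt] at key1 key2
  constructor
  · constructor
    · intro hmem
      have him := hreal 1 hmem
      rw [hzre him, ← hbt, boundary_mem_arc_one_iff h h₂ ht] at hmem
      exact ⟨him, key1.2 hmem⟩
    · rintro ⟨him, hray⟩
      rw [hzre him, ← hbt, boundary_mem_arc_one_iff h h₂ ht]
      exact key1.1 hray
  · constructor
    · intro hmem
      have him := hreal 2 hmem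
      rw [hzre him, ← hbt, boundary_mem_arc_two_iff h h₂ ht] at hmem
      exact ⟨him, key2.2 hmem⟩
    · rintro ⟨him, hray⟩
      rw [hzre him, ← hbt, boundary_mem_arc_two_iff h h₂ ht]
      exact key2.1 hray

/-- The two ray base points have opposite signs: `u < 0 < v` (parametrisation increasing) or
`v < 0 < u` (decreasing), since `mark 3 - 1 < mark 0 < mark 1` and `discParam (mark 0) = 0`.
[folklore] -/
theorem discParam_signs :
    JordanDomain.discParam R.toJordanDomain Φ (R.mark 3 - 1) < 0 ∧
        0 < JordanDomain.discParam R.toJordanDomain Φ (R.mark 1) ∨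
      JordanDomain.discParam R.toJordanDomain Φ (R.mark 1) < 0 ∧
        0 < JordanDomain.discParam R.toJordanDomain Φ (R.mark 3 - 1) := by
  have hg0 := discParam_mark_zero h h₀
  have h01 : R.mark 0 < R.mark 1 := R.strictMono_mark (by decide)
  have h30 : R.mark 3 - 1 < R.mark 0 := by
    linarith [(R.mark_mem 3).2, (R.mark_mem 0).1]
  rcases strictMonoOn_or_strictAntiOn_discParam h h₂ with hg | hg
  · left
    exact ⟨hg0 ▸ hg R.mark_three_sub_one_mem_Ioo R.mark_zero_mem_Ioo h30,
      hg0 ▸ hg R.mark_zero_mem_Ioo R.mark_one_mem_Ioo h01⟩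
  · right
    exact ⟨hg0 ▸ hg R.mark_zero_mem_Ioo R.mark_one_mem_Ioo h01,
      hg0 ▸ hg R.mark_three_sub_one_mem_Ioo R.mark_zero_mem_Ioo h30⟩

omit h₀ in
/-- `ψ` has boundary value `b = pt 1` at `v = discParam (mark 1)`. [folklore] -/
theorem hasBoundaryValue_discParam_mark_one :
    ψ.HasBoundaryValue (JordanDomain.discParam R.toJordanDomain Φ (R.mark 1)) (R.pt 1) := by
  have h1 := h.tendsto_nhdsWithin
    (z := (JordanDomain.discParam R.toJordanDomain Φ (R.mark 1) : ℂ)) (by simp)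
  rwa [h.boundaryExtension_discParam (boundary_ne_apply_one h h₂ R.mark_one_mem_Ioo)] at h1

omit h₀ in
/-- `ψ` has boundary value `d = pt 3` at `u = discParam (mark 3 - 1)`. [folklore] -/
theorem hasBoundaryValue_discParam_mark_three :
    ψ.HasBoundaryValue (JordanDomain.discParam R.toJordanDomain Φ (R.mark 3 - 1)) (R.pt 3) := by
  have h1 := h.tendsto_nhdsWithin
    (z := (JordanDomain.discParam R.toJordanDomain Φ (R.mark 3 - 1) : ℂ)) (by simp)
  rwa [h.boundaryExtension_discParam (boundary_ne_apply_one h h₂ R.mark_three_sub_one_mem_Ioo),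
    R.periodic_boundary.sub_eq] at h1

omit h h₀ h₂ in
/-- A uniformizing datum is determined by monotonicity of `x` and the four boundary values.
[folklore] -/
theorem isUniformizing_of_hasBoundaryValue {φ₀ : ConformalEquiv upperHalfPlaneSet R.carrier}
    {x : Fin 4 → ℝ} (hx : StrictMono x ∨ StrictAnti x)
    (hb0 : φ₀.HasBoundaryValue (x 0) (R.pt 0)) (hb1 : φ₀.HasBoundaryValue (x 1) (R.pt 1))
    (hb2 : φ₀.HasBoundaryValue (x 2) (R.pt 2)) (hb3 : φ₀.HasBoundaryValue (x 3) (R.pt 3)) :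
    R.IsUniformizing φ₀ x :=
  ⟨hx, fun i ↦ by fin_cases i <;> assumption⟩

omit h h₀ h₂ in
/-- Cardy's cross-ratio of `(0, x₁, 1, 2)` is `x₁/(2 - x₁)`. [folklore] -/
theorem crossRatio_zero_one_two {x₁ : ℝ} (hx : x₁ ≠ 2) : crossRatio ![0, x₁, 1, 2] = x₁ / (2 - x₁) := by
  have h : 2 - x₁ ≠ 0 := sub_ne_zero.2 (Ne.symm hx)
  have h' : x₁ - 2 ≠ 0 := sub_ne_zero.2 hx
  simp only [crossRatio, Matrix.cons_val_zero, Matrix.cons_val_one, Matrix.cons_val]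
  rw [div_eq_div_iff (mul_ne_zero (by norm_num) h') h]
  ring

omit h h₀ h₂ in
/-- Cardy's cross-ratio of `(2, x₁, 1, 0)` is `(2 - x₁)/x₁`. [folklore] -/
theorem crossRatio_two_one_zero {x₁ : ℝ} (hx : x₁ ≠ 0) : crossRatio ![2, x₁, 1, 0] = (2 - x₁) / x₁ := by
  simp only [crossRatio, Matrix.cons_val_zero, Matrix.cons_val_one, Matrix.cons_val]
  rw [div_eq_div_iff (mul_ne_zero (by norm_num) (by rwa [sub_zero])) hx]
  ring

omit h h₀ h₂ in
/-- Cardy's cross-ratio of the tuple `(0, 2v/(2v-u), 1, 2)` is `v/(v-u) = |v|/(|u|+|v|)` for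
`u < 0 < v`. [folklore] -/
theorem crossRatio_datum_of_neg_of_pos {u v : ℝ} (hu : u < 0) (hv : 0 < v) :
    crossRatio ![0, 2 * v / (2 * v - u), 1, 2] = |v| / (|u| + |v|) := by
  rw [abs_of_neg hu, abs_of_pos hv]
  have h1 : 2 * v - u ≠ 0 := by linarith
  have h2 : -u + v ≠ 0 := by linarith
  have hx : 2 * v / (2 * v - u) ≠ 2 := by
    rw [Ne, div_eq_iff h1]
    intro h
    exact hu.ne (by linarith)
  rw [crossRatio_zero_one_two hx, div_eq_div_iff (sub_ne_zero.2 (Ne.symm hx)) h2]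
  field_simp
  ring

omit h h₀ h₂ in
/-- Cardy's cross-ratio of the tuple `(2, 2(u-v)/(u-2v), 1, 0)` is `-v/(u-v) = |v|/(|u|+|v|)`
for `v < 0 < u`. [folklore] -/
theorem crossRatio_datum_of_pos_of_neg {u v : ℝ} (hv : v < 0) (hu : 0 < u) :
    crossRatio ![2, 2 * (u - v) / (u - 2 * v), 1, 0] = |v| / (|u| + |v|) := by
  rw [abs_of_neg hv, abs_of_pos hu]
  have h1 : u - 2 * v ≠ 0 := by linarith
  have h2 : u + -v ≠ 0 := by linarith
  have hx : 2 * (u - v) / (u - 2 * v) ≠ 0 := div_ne_zero (by linarith) h1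
  rw [crossRatio_two_one_zero hx, div_eq_div_iff hx h2]
  field_simp
  ring

/-- **A uniformizing datum of `R` built from the chordal map**, with cross-ratio
`|v|/(|u|+|v|)`: precompose `ψ` with a real Möbius self-map of `ℍₒ` sending a monotone real
quadruple to `(0, v, ∞, u)` (Ahlfors (1979), Ch. 3 §3). For `u < 0 < v` take
`M z = (-u/2) z / (1 - z)` and `x = (0, 2v/(2v-u), 1, 2)`; for `v < 0 < u` take
`M z = ((u/2) z - u)/(z - 1)` and `x = (2, 2(u-v)/(u-2v), 1, 0)`. [folklore] -/
theorem exists_isUniformizing_crossRatio_eq :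
    ∃ (φ₀ : ConformalEquiv upperHalfPlaneSet R.carrier) (x : Fin 4 → ℝ), R.IsUniformizing φ₀ x ∧
      crossRatio x = |JordanDomain.discParam R.toJordanDomain Φ (R.mark 1)| /
        (|JordanDomain.discParam R.toJordanDomain Φ (R.mark 3 - 1)| +
          |JordanDomain.discParam R.toJordanDomain Φ (R.mark 1)|) := by
  set v := JordanDomain.discParam R.toJordanDomain Φ (R.mark 1) with hvdef
  set u := JordanDomain.discParam R.toJordanDomain Φ (R.mark 3 - 1) with hudef
  have hbv : ψ.HasBoundaryValue v (R.pt 1) := hasBoundaryValue_discParam_mark_one h h₂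
  have hbu : ψ.HasBoundaryValue u (R.pt 3) := hasBoundaryValue_discParam_mark_three h h₂
  rcases discParam_signs h h₂ h₀ with ⟨hu, hv⟩ | ⟨hv, hu⟩
  · -- `u < 0 < v`: `M z = (-u/2) z / (1 - z)`, `x = (0, 2v/(2v-u), 1, 2)`
    have hdet : 0 < -u / 2 * 1 - 0 * (-1) := by linarith
    have h2vu : 0 < 2 * v - u := by linarith
    set x₁ : ℝ := 2 * v / (2 * v - u) with hx₁
    have hx₁pos : 0 < x₁ := div_pos (by linarith) h2vu
    have hx₁lt : x₁ < 1 := (div_lt_one h2vu).2 (by linarith)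
    refine ⟨(ConformalEquiv.realMobius (-u / 2) 0 (-1) 1 hdet).trans ψ, ![0, x₁, 1, 2],
      isUniformizing_of_hasBoundaryValue (Or.inl ?_) ?_ ?_ ?_ ?_, crossRatio_datum_of_neg_of_pos hu hv⟩
    · refine Fin.strictMono_iff_lt_succ.2 fun i ↦ ?_
      fin_cases i
      · exact hx₁pos
      · exact hx₁lt
      · show (1 : ℝ) < 2
        norm_num
    · refine ConformalEquiv.hasBoundaryValue_realMobius_trans hdet ψ (x := 0) (by norm_num) ?_
      have hreal : (-u / 2 * 0 + 0) / (-1 * 0 + 1) = (0 : ℝ) := by ring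
      rw [hreal]
      exact_mod_cast h₀
    · have hden : -1 * x₁ + 1 ≠ 0 := by linarith
      refine ConformalEquiv.hasBoundaryValue_realMobius_trans hdet ψ (x := x₁) hden ?_
      have hreal : (-u / 2 * x₁ + 0) / (-1 * x₁ + 1) = v := by
        have hden' : -1 * x₁ + 1 ≠ 0 := by
          rw [hx₁, show -1 * (2 * v / (2 * v - u)) + 1 = -u / (2 * v - u) by field_simp; ring]
          exact div_ne_zero (by linarith) h2vu.ne'
        rw [div_eq_iff hden', hx₁]
        field_simp
        ring
      rw [hreal]
      exact hbv
    · exact ConformalEquiv.hasBoundaryValue_realMobius_trans_pole hdet ψ (x := 1) (by norm_num) h₂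
    · refine ConformalEquiv.hasBoundaryValue_realMobius_trans hdet ψ (x := 2) (by norm_num) ?_
      have hreal : (-u / 2 * 2 + 0) / (-1 * 2 + 1) = u := by ring
      rw [hreal]
      exact hbu
  · -- `v < 0 < u`: `M z = ((u/2) z - u)/(z - 1)`, `x = (2, 2(u-v)/(u-2v), 1, 0)`
    have hdet : 0 < u / 2 * (-1) - (-u) * 1 := by linarith
    have hu2v : 0 < u - 2 * v := by linarith
    set x₁ : ℝ := 2 * (u - v) / (u - 2 * v) with hx₁
    have hx₁gt : 1 < x₁ := (one_lt_div hu2v).2 (by linarith)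
    have hx₁lt : x₁ < 2 := (div_lt_iff₀ hu2v).2 (by linarith)
    refine ⟨(ConformalEquiv.realMobius (u / 2) (-u) 1 (-1) hdet).trans ψ, ![2, x₁, 1, 0],
      isUniformizing_of_hasBoundaryValue (Or.inr ?_) ?_ ?_ ?_ ?_, crossRatio_datum_of_pos_of_neg hv hu⟩
    · refine Fin.strictAnti_iff_succ_lt.2 fun i ↦ ?_
      fin_cases i
      · exact hx₁lt
      · exact hx₁gt
      · show (0 : ℝ) < 1
        norm_num
    · refine ConformalEquiv.hasBoundaryValue_realMobius_trans hdet ψ (x := 2) (by norm_num) ?_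
      have hreal : (u / 2 * 2 + -u) / (1 * 2 + -1) = (0 : ℝ) := by ring
      rw [hreal]
      exact_mod_cast h₀
    · have hden : 1 * x₁ + -1 ≠ 0 := by linarith
      refine ConformalEquiv.hasBoundaryValue_realMobius_trans hdet ψ (x := x₁) hden ?_
      have hreal : (u / 2 * x₁ + -u) / (1 * x₁ + -1) = v := by
        have hden' : 1 * x₁ + -1 ≠ 0 := by
          rw [hx₁, show 1 * (2 * (u - v) / (u - 2 * v)) + -1 = u / (u - 2 * v) by field_simp; ring]
          exact div_ne_zero (by linarith) hu2v.ne'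
        rw [div_eq_iff hden', hx₁]
        field_simp
        ring
      rw [hreal]
      exact hbv
    · exact ConformalEquiv.hasBoundaryValue_realMobius_trans_pole hdet ψ (x := 1) (by norm_num) h₂
    · refine ConformalEquiv.hasBoundaryValue_realMobius_trans hdet ψ (x := 0) (by norm_num) ?_
      have hreal : (u / 2 * 0 + -u) / (1 * 0 + -1) = u := by ring
      rw [hreal]
      exact hbu

omit h h₀ h₂ in
/-- **Boundary correspondence for the chordal uniformizing map of a conformal rectangle, from
Carathéodory's theorem (disc form).** Let `R = (Ω; a, b, c, d)` be a conformal rectangle and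
`ψ : ℍₒ → Ω` a chordal uniformizing map of `(Ω; a, c)` (`0 ↦ a`, `∞ ↦ c`) with boundary
extension `Ψ`. Then there are reals `u, v` of opposite signs such that, for `im z ≥ 0`,
`Ψ z ∈ (bc) = R.arc 1` iff `z` is real and lies on the closed real ray from `v` pointing away
from `0`, `Ψ z ∈ (cd) = R.arc 2` iff `z` is real and lies on the closed ray from `u` away from
`0`, and every uniformizing datum `(φ, x)` of `R` has `crossRatio x = |v|/(|u|+|v|)`. Input:
Carathéodory's theorem in disc form (`JordanDomain.exists_continuousOn_extension`, Pommerenke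
(1992), Thm. 2.6); the independence of the cross-ratio from the datum is
`ConformalRectangle.crossRatio_eq_of_isUniformizing_of_disc` (Ahlfors (1979), Ch. 3 §3), itself
proved from the same input. Proof: pull the boundary loop back by `Ψ⁻¹ = C⁻¹ ∘ Φ⁻¹` (`Φ` the
disc extension) to a continuous injective, hence strictly monotone, map of the period window
`(mark c - 1, mark c)` onto `ℝ` vanishing at `mark a`; set `v = Ψ⁻¹(b)`, `u = Ψ⁻¹(d)`; the arcs
are images of parameter intervals on either side of `mark a`. For the cross-ratio, `ψ ∘ M` with
a suitable real Möbius `M` is a uniformizing datum with cross-ratio `|v|/(|u|+|v|)`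
(`exists_isUniformizing_crossRatio_eq`). [cite: PommerenkeBBCM1992, Thm. 2.6] -/
theorem exists_rays_of_isChordalUniformizing_of_disc
    (hC : JordanDomain.exists_continuousOn_extension) (R : ConformalRectangle)
    {ψ : ConformalEquiv upperHalfPlaneSet (R.chord 0 2 (by decide)).carrier}
    (hψ : (R.chord 0 2 (by decide)).IsChordalUniformizing ψ) :
    ∃ u v : ℝ, (u < 0 ∧ 0 < v ∨ v < 0 ∧ 0 < u) ∧
      (∀ z : ℂ, 0 ≤ z.im → (ψ.boundaryExtension z ∈ R.arc 1 ↔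
          z.im = 0 ∧ (0 < v → v ≤ z.re) ∧ (v < 0 → z.re ≤ v))) ∧
      (∀ z : ℂ, 0 ≤ z.im → (ψ.boundaryExtension z ∈ R.arc 2 ↔
          z.im = 0 ∧ (0 < u → u ≤ z.re) ∧ (u < 0 → z.re ≤ u))) ∧
      ∀ (φ : ConformalEquiv upperHalfPlaneSet R.carrier) (x : Fin 4 → ℝ), R.IsUniformizing φ x →
        crossRatio x = |v| / (|u| + |v|) := by
  change ConformalEquiv upperHalfPlaneSet R.carrier at ψ
  have h₀ : ψ.HasBoundaryValue 0 (R.pt 0) := hψ.1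
  have h₂ : ψ.HasBoundaryValueAtInfty (R.pt 2) := hψ.2
  obtain ⟨Φ, h⟩ := JordanDomain.exists_isDiscExtension (D := R.toJordanDomain) hC ψ
  refine ⟨JordanDomain.discParam R.toJordanDomain Φ (R.mark 3 - 1),
    JordanDomain.discParam R.toJordanDomain Φ (R.mark 1), discParam_signs h h₂ h₀,
    fun z hz ↦ (boundaryExtension_mem_arc_iff h h₂ h₀ hz).1,
    fun z hz ↦ (boundaryExtension_mem_arc_iff h h₂ h₀ hz).2, fun φ x hφx ↦ ?_⟩
  obtain ⟨φ₀, x₀, hφ₀, hcr⟩ := exists_isUniformizing_crossRatio_eq h h₂ h₀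
  rw [crossRatio_eq_of_isUniformizing_of_disc hC hφx hφ₀, hcr]

end ConformalRectangle

end Literature.Probability.RandomPlanarGeometry
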